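import Summits.AtomisticToContinuum.Crystallization.Theses.HullExactificationCascade

/-!
# `RobustBarlowTemplate` (crux stmt-AtomisticToContinuum-12088, routes `HullExactificationCascade` /
# `DisclinationRation`): the hypotheses `S.Nonempty` and "every point is `1/20`-good" are load-bearing
# (negative-side support, refuter crux-disprover seat, cycle 1)

`RobustBarlowTemplate` claims: for every `δ > 0`, every nonempty `δ`-separated `S ⊆ ℝ³` all of whose
points are `1/20`-good (first shell within `13/10 · d(y)`, rescaled by `d(y)⁻¹`, matched after a linear
isometry to the FCC or the HCP kissing pattern, each point moved by `≤ 1/20`) is the bijective image of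
an ideal Barlow stacking `barlowStacking 1 √(2/3) s` (`IsHaggSeq s`) under a map `1/20`-close to a
similarity on every unit cluster.

Here we record, sorry-free, the two cheap boundary facts (stated inline; no proposition is defined
under `Summits/`):

* `robustBarlowTemplate_false_without_nonempty` — with `S.Nonempty` deleted the statement is FALSE:
  `S = ∅` is vacuously separated and good, but the template `barlowStacking 1 √(2/3) s` is nonempty, so
  no `Set.BijOn Φ (template) ∅`.
* `robustBarlowTemplate_false_without_good` — with the pointwise goodness deleted the statement is
  FALSE: `S = {0}` is nonempty and `1`-separated, but two distinct template points
  (`barlowPos … 0 0 0 ≠ barlowPos … 0 1 0`, in-layer distance `≥ 1`) cannot be injected into it.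

Moral for provers: trivial as they are, these are the only two hypotheses a proof can discharge by
"structural" means; the disprover's work file `Cruxes/RobustBarlowTemplate/Disproof.lean` explains why
`δ`-separation is probably NOT load-bearing for truth (only for the covering-space proof) and why the
metric pattern match (not twelve-ness of the shell) is.  This file does NOT refute the crux.
-/

noncomputable section

namespace Summit.AtomisticToContinuum.Crystallization.Theorems.RobustBarlowTemplate.Negative

open Literature.MathematicalPhysics.StatisticalMechanics Literature.Geometry.DiscreteGeometry

/-- Two distinct points of every ideal template. [folklore] -/
theorem barlowPos_zero_zero_ne_zero_one (s : ℤ → ℤ) :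
    barlowPos 1 (Real.sqrt (2 / 3)) s 0 0 0 ≠ barlowPos 1 (Real.sqrt (2 / 3)) s 0 1 0 := by
  intro h
  have h1 : (1 : ℝ) ≤ dist (barlowPos 1 (Real.sqrt (2 / 3)) s 0 0 0)
      (barlowPos 1 (Real.sqrt (2 / 3)) s 0 1 0) :=
    le_dist_barlowPos_of_ne 1 (Real.sqrt (2 / 3)) s zero_le_one (by simp)
  rw [h, dist_self] at h1
  exact absurd h1 (by norm_num)

/-- The conclusion of the crux fails for `S = ∅`. [folklore] -/
theorem not_conclusion_empty :
    ¬ (∃ s : ℤ → ℤ, IsHaggSeq s ∧ ∃ Φ : (EuclideanSpace ℝ (Fin 3)) → (EuclideanSpace ℝ (Fin 3)),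
        Set.BijOn Φ (barlowStacking 1 (Real.sqrt (2 / 3)) s) (∅ : Set (EuclideanSpace ℝ (Fin 3))) ∧
        ∀ p ∈ barlowStacking 1 (Real.sqrt (2 / 3)) s, ∃ A : (EuclideanSpace ℝ (Fin 3)) →ₗᵢ[ℝ] (EuclideanSpace ℝ (Fin 3)), ∃ l : ℝ, 0 < l ∧
          ∀ q ∈ barlowStacking 1 (Real.sqrt (2 / 3)) s, dist q p ≤ 1 →
            dist (Φ q) (Φ p + l • A (q - p)) ≤ 1 / 20 * l) := by
  rintro ⟨s, -, Φ, hbij, -⟩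
  exact hbij.mapsTo (barlowPos_mem (a := 1) (h := Real.sqrt (2 / 3)) (s := s) 0 0 0)

/-- The conclusion of the crux fails for a singleton. [folklore] -/
theorem not_conclusion_singleton (x : (EuclideanSpace ℝ (Fin 3))) :
    ¬ (∃ s : ℤ → ℤ, IsHaggSeq s ∧ ∃ Φ : (EuclideanSpace ℝ (Fin 3)) → (EuclideanSpace ℝ (Fin 3)),
        Set.BijOn Φ (barlowStacking 1 (Real.sqrt (2 / 3)) s) ({x} : Set (EuclideanSpace ℝ (Fin 3))) ∧
        ∀ p ∈ barlowStacking 1 (Real.sqrt (2 / 3)) s, ∃ A : (EuclideanSpace ℝ (Fin 3)) →ₗᵢ[ℝ] (EuclideanSpace ℝ (Fin 3)), ∃ l : ℝ, 0 < l ∧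
          ∀ q ∈ barlowStacking 1 (Real.sqrt (2 / 3)) s, dist q p ≤ 1 →
            dist (Φ q) (Φ p + l • A (q - p)) ≤ 1 / 20 * l) := by
  rintro ⟨s, -, Φ, hbij, -⟩
  have h0 : Φ (barlowPos 1 (Real.sqrt (2 / 3)) s 0 0 0) = x := hbij.mapsTo (barlowPos_mem 0 0 0)
  have h1 : Φ (barlowPos 1 (Real.sqrt (2 / 3)) s 0 1 0) = x := hbij.mapsTo (barlowPos_mem 0 1 0)
  exact barlowPos_zero_zero_ne_zero_one s
    (hbij.injOn (barlowPos_mem 0 0 0) (barlowPos_mem 0 1 0) (h0.trans h1.symm))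

/-- **`S.Nonempty` is load-bearing in `RobustBarlowTemplate`**: the crux with `S.Nonempty` deleted
(stated inline, verbatim otherwise) is false — witness `δ = 1`, `S = ∅`. [folklore] -/
theorem robustBarlowTemplate_false_without_nonempty :
    ¬ (∀ δ : ℝ, 0 < δ → ∀ S : Set (EuclideanSpace ℝ (Fin 3)), (∀ y ∈ S, ∀ z ∈ S, y ≠ z → δ ≤ dist y z) →
      (∀ y ∈ S, (let d : ℝ := sInf ((fun z => dist z y) '' (S \ {y}));
        let T : Set (EuclideanSpace ℝ (Fin 3)) := {z : (EuclideanSpace ℝ (Fin 3)) | z ∈ S ∧ z ≠ y ∧ dist z y < 13 / 10 * d};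
        ∃ A : (EuclideanSpace ℝ (Fin 3)) →ₗᵢ[ℝ] (EuclideanSpace ℝ (Fin 3)),
          (∃ e : ↥T ≃ ↥fccKissingPattern, ∀ t : ↥T,
            dist (d⁻¹ • ((t : (EuclideanSpace ℝ (Fin 3))) - y)) (A ((e t : ↥fccKissingPattern) : (EuclideanSpace ℝ (Fin 3)))) ≤ 1 / 20) ∨
          (∃ e : ↥T ≃ ↥hcpKissingPattern, ∀ t : ↥T,
            dist (d⁻¹ • ((t : (EuclideanSpace ℝ (Fin 3))) - y)) (A ((e t : ↥hcpKissingPattern) : (EuclideanSpace ℝ (Fin 3)))) ≤ 1 / 20))) →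
      (∃ s : ℤ → ℤ, IsHaggSeq s ∧ ∃ Φ : (EuclideanSpace ℝ (Fin 3)) → (EuclideanSpace ℝ (Fin 3)),
        Set.BijOn Φ (barlowStacking 1 (Real.sqrt (2 / 3)) s) S ∧
        ∀ p ∈ barlowStacking 1 (Real.sqrt (2 / 3)) s, ∃ A : (EuclideanSpace ℝ (Fin 3)) →ₗᵢ[ℝ] (EuclideanSpace ℝ (Fin 3)), ∃ l : ℝ, 0 < l ∧
          ∀ q ∈ barlowStacking 1 (Real.sqrt (2 / 3)) s, dist q p ≤ 1 →
            dist (Φ q) (Φ p + l • A (q - p)) ≤ 1 / 20 * l)) :=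
  fun h => not_conclusion_empty (h 1 one_pos ∅ (by simp) (by simp))

/-- **Pointwise goodness is load-bearing in `RobustBarlowTemplate`**: the crux with the goodness
hypothesis deleted (stated inline, verbatim otherwise) is false — witness `δ = 1`, `S = {0}`.
[folklore] -/
theorem robustBarlowTemplate_false_without_good :
    ¬ (∀ δ : ℝ, 0 < δ → ∀ S : Set (EuclideanSpace ℝ (Fin 3)), S.Nonempty → (∀ y ∈ S, ∀ z ∈ S, y ≠ z → δ ≤ dist y z) →
      (∃ s : ℤ → ℤ, IsHaggSeq s ∧ ∃ Φ : (EuclideanSpace ℝ (Fin 3)) → (EuclideanSpace ℝ (Fin 3)),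
        Set.BijOn Φ (barlowStacking 1 (Real.sqrt (2 / 3)) s) S ∧
        ∀ p ∈ barlowStacking 1 (Real.sqrt (2 / 3)) s, ∃ A : (EuclideanSpace ℝ (Fin 3)) →ₗᵢ[ℝ] (EuclideanSpace ℝ (Fin 3)), ∃ l : ℝ, 0 < l ∧
          ∀ q ∈ barlowStacking 1 (Real.sqrt (2 / 3)) s, dist q p ≤ 1 →
            dist (Φ q) (Φ p + l • A (q - p)) ≤ 1 / 20 * l)) :=
  fun h => not_conclusion_singleton 0
    (h 1 one_pos {0} (Set.singleton_nonempty 0) (by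
      intro y hy z hz hyz
      rw [Set.mem_singleton_iff] at hy hz
      exact absurd (hy.trans hz.symm) hyz))

end Summit.AtomisticToContinuum.Crystallization.Theorems.RobustBarlowTemplate.Negative

end
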